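import Literature.Computability.Complexity.MajorityOfThresholdsInnerProduct
import HarnessLib

/-!
# Threshold covers by fat matchings: the discriminator lemma and the `IP` Hadamard graph

S. Jukna, *Boolean Function Complexity* (Springer 2012), §11.9 (pp. 335–336). A family
`F₁, …, F_t` of members of a set system `𝓕` on a finite ground set is a *threshold cover* of a set
`A` if for some `k`, `z ∈ A` iff `z` belongs to at least `k` of the `Fᵢ`; `thr_𝓕(A)` is the least
such `t`. **Lemma 11.30** (Discriminator Lemma): `thr_𝓕(A) ≥ 1/Δ_𝓕(A)` where
`Δ_F(A) = | |A ∩ F|/|A| − |Ā ∩ F|/|Ā| |`. A *fat matching* on `X × Y` is a union of vertex-disjoint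
bipartite cliques `⋃ᵢ Sᵢ × Rᵢ` (§11.7). **Theorem 11.31**: a threshold cover of an `n × n` Hadamard
graph by fat matchings has `Ω(√n)` members (Lindsey's lemma blockwise:
`| |A ∩ F| − |Ā ∩ F| | ≤ Σᵢ √(sᵢ rᵢ n) ≤ √n Σᵢ (sᵢ + rᵢ)/2 ≤ n^{3/2}`); **Corollary 11.32**: for the
graph of `IP_m` (`n = 2^m`) the bound is `Ω(2^{m/2})`. By Lemma 11.26 (`fat(G) = Σ₃^⊕(G)`, not
formalized here) these are lower bounds on the top fan-in of `Σ₃^⊕` circuits with a threshold gate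
on top.

This file PROVES (no named fact), in the set-system form:
* `IsThresholdCover`, `Jukna2012_lemma1130` — Lemma 11.30, from the weighted discriminator lemma
  `Jukna2012_discriminatorLemma` (Lemma 11.36, `MajorityOfThresholdsInnerProduct.lean`) with unit
  weights;
* `IsFatMatching` (blocks labelled by positive integers), `FatMatching.abs_sum_ipSign_le` — for a fat
  matching `F` on `{0,1}^m × {0,1}^m`, `|Σ_{(x,y) ∈ F} H(x,y)| ≤ 2^m·√(2^m)` (`H = (−1)^{IP}`);
* `Jukna2012_cor1132` — **Corollary 11.32** (with Theorem 11.31's proof): every threshold cover of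
  the graph `{(x, y) : IP_m(x, y) = 1}` by fat matchings has `t ≥ √(2^m)/4` members (`m ≥ 1`; the
  book's `Ω(√n)` with an explicit constant, the two colour classes of the `IP` matrix having
  `(4^m ∓ 2^m)/2` elements).
* `ThrAndXor`, `ThrAndXor.isFatMatching_gate`, `Jukna2012_cor1132_circuit` — the circuit form: a
  `Σ₃^⊕` circuit with a THRESHOLD gate on top (middle level: ANDs of parity constraints
  `⟨s, x⟩ ⊕ ⟨t, y⟩ = b` over `𝔽₂`) computing `IP_m` has top fan-in `t ≥ √(2^m)/4`; the set accepted
  by an AND of parities is a fat matching (the blocks are the fibres of the signature vectors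
  `x ↦ (⟨s_j, x⟩)_j`, `y ↦ (⟨t_j, y⟩ ⊕ b_j)_j` — the content of Lemma 11.26 for this class).
* `IsFatMatching.card_le_of_free`, `Jukna2012_thm1125` (+ `_circuit`) — **Theorem 11.25**: a fat
  matching inside a `K_{a,b}`-free bipartite graph `G ⊆ X × Y` has `≤ (a−1)|Y| + (b−1)|X|` edges, so
  `G` is not the union of fewer than `|G| / ((a−1)|Y| + (b−1)|X|)` fat matchings (the book's
  `|G|/((a+b)n)` for `n × n` graphs); for `Σ₃^⊕` circuits with an OR gate on top (threshold `1`)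
  this bounds the top fan-in.
* `card_disjGraph` (`3^m` pairs of disjoint subsets of `[m]`), `disjGraph_biclique`
  (`S × R ⊆ DISJ ⇒ |S|·|R| ≤ 2^m`, so `DISJ` is `K_{a,a}`-free for `a = ⌊√(2^m)⌋ + 1`),
  `Jukna2012_thm1129` — **Theorem 11.29**: every `Σ₃^⊕` circuit (OR of ANDs of parities) for the
  disjointness function `DISJ_{2m}` has top fan-in `t` with `3^m ≤ t · ⌊√(2^m)⌋ · 2^{m+1}`, i.e.
  `t ≥ (3/2^{3/2})^m / 2 ≥ 2^{0.08 m}/2`.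

## References
* S. Jukna, *Boolean Function Complexity: Advances and Frontiers*, Springer 2012, §11.8–11.9,
  Theorem 11.25 (p. 333), Theorem 11.29 (pp. 334–335), Lemma 11.30, Theorem 11.31, Corollary 11.32
  (pp. 335–336); §11.7 (fat matchings) [Jukna2012].
-/

namespace Literature.Computability.Complexity

open Finset

/-! ### Threshold covers and the discriminator lemma (Lemma 11.30) -/

/-- `F₁, …, F_t` is a **threshold cover** of `A` with threshold `k`: `z ∈ A` iff `z` lies in at least
`k` of the sets `Fᵢ`. [cite: Jukna2012, §11.9 (p. 335)] -/
def IsThresholdCover {Z : Type*} [DecidableEq Z] {t : ℕ} (F : Fin t → Finset Z) (k : ℕ)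
    (A : Finset Z) : Prop :=
  ∀ z, z ∈ A ↔ k ≤ ((univ : Finset (Fin t)).filter fun i => z ∈ F i).card

/-- **Lemma 11.30 (Discriminator Lemma): `thr_𝓕(A) ≥ 1/Δ_𝓕(A)`.** If `F₁, …, F_t` is a threshold
cover of `A` (`A`, `Ā` nonempty) then some `Fᵢ` discriminates:
`1 ≤ t · | |A ∩ Fᵢ|/|A| − |Ā ∩ Fᵢ|/|Ā| |`. [cite: Jukna2012, Lemma 11.30 (p. 335)] -/
theorem Jukna2012_lemma1130 {Z : Type*} [Fintype Z] [DecidableEq Z] {t : ℕ} (F : Fin t → Finset Z)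
    (k : ℕ) (A : Finset Z) (hA : A.Nonempty) (hAc : Aᶜ.Nonempty) (hcov : IsThresholdCover F k A) :
    ∃ i, (1 : ℝ) ≤ t * |((A ∩ F i).card : ℝ) / A.card - ((Aᶜ ∩ F i).card : ℝ) / Aᶜ.card| := by
  classical
  have hcount : ∀ z, (∑ i : Fin t, (if decide (z ∈ F i) = true then (1 : ℤ) else 0)) =
      (((univ : Finset (Fin t)).filter fun i => z ∈ F i).card : ℤ) := by
    intro z
    rw [Finset.sum_boole]
    simp
  obtain ⟨i, hi⟩ := Jukna2012_discriminatorLemma (fun i z => decide (z ∈ F i)) (fun _ => (1 : ℤ))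
    (k : ℤ) A Aᶜ hA hAc
    (fun z hz => by rw [hcount z]; exact_mod_cast (hcov z).1 hz)
    (fun z hz => by
      rw [hcount z]
      have : ¬ k ≤ ((univ : Finset (Fin t)).filter fun i => z ∈ F i).card :=
        fun h => (Finset.mem_compl.1 hz) ((hcov z).2 h)
      omega)
  refine ⟨i, ?_⟩
  have h1 : (∑ _j : Fin t, |((1 : ℤ) : ℝ)|) = t := by simp
  have h2 : ∀ S : Finset Z, (S.filter fun z => decide (z ∈ F i) = true) = S ∩ F i := by
    intro S; ext z; simp [Finset.mem_inter]
  rw [h1, h2, h2] at hi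
  exact hi

/-! ### Fat matchings -/

/-- A **fat matching** on `X × Y`: a union of vertex-disjoint bipartite cliques `⋃ₖ Sₖ × Rₖ`
(encoded by block labels `c : X → ℕ`, `d : Y → ℕ`, label `0` = uncovered vertex; `(x, y) ∈ F` iff
`x` and `y` carry the same positive label). [cite: Jukna2012, §11.7 and §11.9 (p. 336: "for every fat matching `F = ⋃ Sᵢ × Rᵢ`")] -/
def IsFatMatching {X Y : Type*} (F : Finset (X × Y)) : Prop :=
  ∃ (c : X → ℕ) (d : Y → ℕ), ∀ x y, (x, y) ∈ F ↔ c x ≠ 0 ∧ c x = d y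

namespace FatMatching

variable {m : ℕ}

/-- `√(s·r) ≤ (s + r)/2`. [folklore] -/
private theorem sqrt_mul_le_half_add {s r : ℝ} (hs : 0 ≤ s) (hr : 0 ≤ r) :
    Real.sqrt (s * r) ≤ (s + r) / 2 := by
  rw [Real.sqrt_le_left (by linarith)]
  nlinarith [sq_nonneg (s - r)]

/-- **Lindsey blockwise**: for a fat matching `F` on `{0,1}^m × {0,1}^m`,
`|Σ_{(x,y) ∈ F} H(x,y)| ≤ Σₖ √(sₖ rₖ 2^m) ≤ √(2^m)·Σₖ (sₖ + rₖ)/2 ≤ 2^m √(2^m)`.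
[cite: Jukna2012, Theorem 11.31 (proof, p. 336)] -/
theorem abs_sum_ipSign_le (F : Finset ((Fin m → Bool) × (Fin m → Bool))) (hF : IsFatMatching F) :
    |∑ p ∈ F, ipSign p.1 p.2| ≤ (2 : ℝ) ^ m * Real.sqrt ((2 : ℝ) ^ m) := by
  classical
  obtain ⟨c, d, hcd⟩ := hF
  set L : Finset ℕ := ((univ : Finset (Fin m → Bool)).image c).erase 0 with hL
  set S : ℕ → Finset (Fin m → Bool) := fun k => univ.filter fun x => c x = k with hS
  set R : ℕ → Finset (Fin m → Bool) := fun k => univ.filter fun y => d y = k with hR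
  -- `F` is the disjoint union of the blocks `Sₖ × Rₖ`, `k ∈ L`
  have hFeq : F = L.biUnion fun k => S k ×ˢ R k := by
    ext ⟨x, y⟩
    simp only [mem_biUnion, mem_product, hS, hR, mem_filter, mem_univ, true_and, hL, mem_erase,
      mem_image]
    constructor
    · intro h
      obtain ⟨h0, hxy⟩ := (hcd x y).1 h
      exact ⟨c x, ⟨h0, x, rfl⟩, rfl, hxy.symm⟩
    · rintro ⟨k, ⟨hk0, _⟩, hx, hy⟩
      exact (hcd x y).2 ⟨hx ▸ hk0, hx.trans hy.symm⟩
  have hdisj : (L : Set ℕ).PairwiseDisjoint fun k => S k ×ˢ R k := by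
    intro k _ k' _ hkk'
    rw [Function.onFun, disjoint_left]
    rintro ⟨x, y⟩ h h'
    rw [mem_product] at h h'
    simp only [hS, mem_filter, mem_univ, true_and] at h h'
    exact hkk' (h.1.symm.trans h'.1)
  rw [hFeq, sum_biUnion hdisj]
  -- blockwise Lindsey + `√(sr) ≤ (s+r)/2`
  have hblock : ∀ k, |∑ p ∈ S k ×ˢ R k, ipSign p.1 p.2| ≤
      Real.sqrt ((2 : ℝ) ^ m) * (((S k).card + (R k).card) / 2) := by
    intro k
    rw [sum_product]
    calc |∑ x ∈ S k, ∑ y ∈ R k, ipSign x y|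
        ≤ Real.sqrt ((S k).card * ((2 : ℝ) ^ m * (R k).card)) := IPStaircase.rect_sum_le _ _
      _ = Real.sqrt ((2 : ℝ) ^ m) * Real.sqrt ((S k).card * (R k).card) := by
          rw [← Real.sqrt_mul (by positivity)]
          congr 1; ring
      _ ≤ Real.sqrt ((2 : ℝ) ^ m) * (((S k).card + (R k).card) / 2) := by
          gcongr
          exact sqrt_mul_le_half_add (Nat.cast_nonneg _) (Nat.cast_nonneg _)
  -- the blocks have disjoint sides: `Σₖ sₖ ≤ 2^m`, `Σₖ rₖ ≤ 2^m`
  have hcardX : ((univ : Finset (Fin m → Bool)).card : ℝ) = (2 : ℝ) ^ m := by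
    rw [card_univ, Fintype.card_fun, Fintype.card_bool, Fintype.card_fin]; push_cast; ring
  have hSsum : (∑ k ∈ L, ((S k).card : ℝ)) ≤ (2 : ℝ) ^ m := by
    have h := Finset.sum_card_fiberwise_eq_card_filter (univ : Finset (Fin m → Bool)) L c
    have h' : (∑ k ∈ L, (S k).card) ≤ (univ : Finset (Fin m → Bool)).card := by
      rw [h]; exact card_filter_le _ _
    rw [← hcardX]; exact_mod_cast h'
  have hRsum : (∑ k ∈ L, ((R k).card : ℝ)) ≤ (2 : ℝ) ^ m := by
    have h := Finset.sum_card_fiberwise_eq_card_filter (univ : Finset (Fin m → Bool)) L d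
    have h' : (∑ k ∈ L, (R k).card) ≤ (univ : Finset (Fin m → Bool)).card := by
      rw [h]; exact card_filter_le _ _
    rw [← hcardX]; exact_mod_cast h'
  calc |∑ k ∈ L, ∑ p ∈ S k ×ˢ R k, ipSign p.1 p.2|
      ≤ ∑ k ∈ L, |∑ p ∈ S k ×ˢ R k, ipSign p.1 p.2| := abs_sum_le_sum_abs _ _
    _ ≤ ∑ k ∈ L, Real.sqrt ((2 : ℝ) ^ m) * (((S k).card + (R k).card) / 2) :=
        sum_le_sum fun k _ => hblock k
    _ = Real.sqrt ((2 : ℝ) ^ m) * ((∑ k ∈ L, ((S k).card : ℝ) + ∑ k ∈ L, ((R k).card : ℝ)) / 2) := by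
        rw [← mul_sum, ← sum_div, sum_add_distrib]
    _ ≤ Real.sqrt ((2 : ℝ) ^ m) * (((2 : ℝ) ^ m + (2 : ℝ) ^ m) / 2) := by gcongr
    _ = (2 : ℝ) ^ m * Real.sqrt ((2 : ℝ) ^ m) := by ring

end FatMatching

/-! ### Corollary 11.32: the `IP` Hadamard graph -/

/-- The two colour classes of the `IP_m` matrix: `#{IP = 0} − #{IP = 1} = 2^m` and
`#{IP = 0} + #{IP = 1} = 4^m`. [cite: Jukna2012, Theorem 11.31 (proof, p. 336: "both the graph `A` and its bipartite complement have `Θ(n²)` edges")] -/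
theorem card_ipBool_classes (m : ℕ) :
    ((((univ : Finset ((Fin m → Bool) × (Fin m → Bool))).filter fun p => ipBool p.1 p.2 = false).card
        : ℕ) : ℝ) = ((4 : ℝ) ^ m + (2 : ℝ) ^ m) / 2 ∧
    ((((univ : Finset ((Fin m → Bool) × (Fin m → Bool))).filter fun p => ipBool p.1 p.2 = true).card
        : ℕ) : ℝ) = ((4 : ℝ) ^ m - (2 : ℝ) ^ m) / 2 := by
  classical
  set P := (univ : Finset ((Fin m → Bool) × (Fin m → Bool)))
  have htot : (((P.filter fun p => ipBool p.1 p.2 = false).card : ℝ) +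
      ((P.filter fun p => ipBool p.1 p.2 = true).card : ℝ)) = (4 : ℝ) ^ m := by
    have h := Finset.card_filter_add_card_filter_not (s := P) (fun p => ipBool p.1 p.2 = false)
    have h2 : (P.filter fun p => ¬ ipBool p.1 p.2 = false) = P.filter fun p => ipBool p.1 p.2 = true := by
      ext p; simp
    rw [h2] at h
    have hP : (P.card : ℝ) = (4 : ℝ) ^ m := by
      rw [card_univ, Fintype.card_prod, Fintype.card_fun, Fintype.card_bool, Fintype.card_fin]
      push_cast
      rw [← mul_pow]; norm_num
    rw [← hP]; exact_mod_cast h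
  have hdiff : (((P.filter fun p => ipBool p.1 p.2 = false).card : ℝ) -
      ((P.filter fun p => ipBool p.1 p.2 = true).card : ℝ)) = (2 : ℝ) ^ m := by
    have hs : ∑ p ∈ P, ipSign p.1 p.2 = (2 : ℝ) ^ m := by
      rw [← sum_ipSign_all (n := m), ← Finset.sum_product' (f := fun x y => ipSign x y)]
      rfl
    have hsplit : ∑ p ∈ P, ipSign p.1 p.2 =
        ∑ p ∈ P, ((if ipBool p.1 p.2 = false then (1 : ℝ) else 0) -
          (if ipBool p.1 p.2 = true then (1 : ℝ) else 0)) := by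
      refine sum_congr rfl fun p _ => ?_
      rw [ipSign_eq_ite]
      cases ipBool p.1 p.2 <;> simp
    rw [hsplit, sum_sub_distrib, Finset.sum_boole, Finset.sum_boole] at hs
    simpa using hs
  constructor <;> linarith

/-- **Corollary 11.32 (with the proof of Theorem 11.31): threshold covers of the `IP` Hadamard graph
by fat matchings are large.** If `F₁, …, F_t` are fat matchings on `{0,1}^m × {0,1}^m` (`m ≥ 1`)
forming a threshold cover of `{(x, y) : IP_m(x, y) = 1}`, then `√(2^m) ≤ 4t`, i.e.
`t = Ω(2^{m/2})`; by Lemma 11.26 this is the top fan-in of any `Σ₃^⊕` circuit with a threshold gate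
on top computing `IP`. [cite: Jukna2012, Corollary 11.32 and Theorem 11.31 (p. 336)] -/
theorem Jukna2012_cor1132 {m t : ℕ} (hm : 1 ≤ m)
    (F : Fin t → Finset ((Fin m → Bool) × (Fin m → Bool))) (hF : ∀ i, IsFatMatching (F i))
    (k : ℕ) (hcov : IsThresholdCover F k (univ.filter fun p => ipBool p.1 p.2 = true)) :
    Real.sqrt ((2 : ℝ) ^ m) ≤ 4 * t := by
  classical
  set A := (univ : Finset ((Fin m → Bool) × (Fin m → Bool))).filter fun p => ipBool p.1 p.2 = true
    with hA
  have hAc : Aᶜ = univ.filter fun p => ipBool p.1 p.2 = false := by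
    ext p; simp [hA]
  obtain ⟨hB, hAcard⟩ := card_ipBool_classes m
  rw [← hAc] at hB
  set n : ℝ := (2 : ℝ) ^ m with hn
  have h4 : (4 : ℝ) ^ m = n * n := by rw [hn, ← mul_pow]; norm_num
  have hn2 : (2 : ℝ) ≤ n := by
    calc (2 : ℝ) = 2 ^ 1 := by norm_num
      _ ≤ 2 ^ m := pow_le_pow_right₀ (by norm_num) hm
  have hsqrt1 : 1 ≤ Real.sqrt n := by
    rw [Real.le_sqrt (by norm_num) (by linarith)]; linarith
  have hsqrtn : Real.sqrt n ≤ n := by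
    rw [Real.sqrt_le_left (by linarith)]; nlinarith
  -- the two classes are nonempty (`m ≥ 1`)
  have hApos : (0 : ℝ) < A.card := by rw [hAcard, h4]; nlinarith
  have hBpos : (0 : ℝ) < Aᶜ.card := by rw [hB, h4]; nlinarith
  have hAne : A.Nonempty := by
    rw [← Finset.card_pos]; exact_mod_cast hApos
  have hBne : Aᶜ.Nonempty := by
    rw [← Finset.card_pos]; exact_mod_cast hBpos
  obtain ⟨i, hi⟩ := Jukna2012_lemma1130 F k A hAne hBne hcov
  -- `Δ_{F_i}(A) ≤ 4/√n`
  set p : ℝ := ((A ∩ F i).card : ℝ)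
  set q : ℝ := ((Aᶜ ∩ F i).card : ℝ)
  have hD : |q - p| ≤ n * Real.sqrt n := by
    -- `q − p = Σ_{F_i} H`
    have hsum : ∑ z ∈ F i, ipSign z.1 z.2 = q - p := by
      have hsplit : ∑ z ∈ F i, ipSign z.1 z.2 =
          ∑ z ∈ F i, ((if z ∈ Aᶜ then (1 : ℝ) else 0) - (if z ∈ A then (1 : ℝ) else 0)) := by
        refine sum_congr rfl fun z _ => ?_
        rw [ipSign_eq_ite]
        simp only [hA, Finset.mem_compl, mem_filter, mem_univ, true_and]
        cases ipBool z.1 z.2 <;> simp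
      rw [hsplit, sum_sub_distrib, Finset.sum_boole, Finset.sum_boole]
      simp only [p, q]
      congr 2
      · congr 1; ext z; simp [Finset.mem_inter, and_comm]
      · congr 1; ext z; simp [Finset.mem_inter, and_comm]
    rw [← hsum]
    exact FatMatching.abs_sum_ipSign_le (F i) (hF i)
  have hp_le : p ≤ A.card := by
    have : (A ∩ F i).card ≤ A.card := card_le_card inter_subset_left
    simp only [p]
    exact_mod_cast this
  have hp0 : 0 ≤ p := Nat.cast_nonneg _
  -- `p/|A| − q/|Ā| = (p·n − (q − p)|A|) / (|A||Ā|)` since `|Ā| − |A| = n`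
  have hBA : (Aᶜ.card : ℝ) = A.card + n := by rw [hB, hAcard]; ring
  have hΔ : |p / A.card - q / Aᶜ.card| ≤ 4 / Real.sqrt n := by
    have heq : p / A.card - q / Aᶜ.card = (p * n - (q - p) * A.card) / (A.card * Aᶜ.card) := by
      field_simp
      rw [hBA]; ring
    rw [heq, abs_div, abs_of_pos (mul_pos hApos hBpos)]
    rw [div_le_div_iff₀ (mul_pos hApos hBpos) (lt_of_lt_of_le one_pos hsqrt1)]
    have h1 : |p * n - (q - p) * A.card| ≤ p * n + |q - p| * A.card := by
      calc |p * n - (q - p) * A.card| ≤ |p * n| + |(q - p) * A.card| := abs_sub _ _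
        _ = p * n + |q - p| * A.card := by
            rw [abs_of_nonneg (by positivity), abs_mul, abs_of_pos hApos]
    have h2 : p * n + |q - p| * A.card ≤ A.card * n + n * Real.sqrt n * A.card := by
      gcongr
    -- `|A| n (1 + √n) √n ≤ 4 |A| |Ā|` as `|Ā| ≥ n²/2` and `1 ≤ √n`
    have hsq : Real.sqrt n * Real.sqrt n = n := Real.mul_self_sqrt (by linarith)
    have hBge : n * n / 2 ≤ Aᶜ.card := by rw [hB, h4]; linarith
    calc |p * n - (q - p) * A.card| * Real.sqrt n
        ≤ (A.card * n + n * Real.sqrt n * A.card) * Real.sqrt n := by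
          gcongr; exact h1.trans h2
      _ = A.card * n * Real.sqrt n + A.card * n * (Real.sqrt n * Real.sqrt n) := by ring
      _ = A.card * (n * Real.sqrt n + n * n) := by rw [hsq]; ring
      _ ≤ A.card * (n * n + n * n) :=
          mul_le_mul_of_nonneg_left (by nlinarith [hsqrtn, hn2]) hApos.le
      _ ≤ 4 * (A.card * Aᶜ.card) := by nlinarith
  have := hi.trans (mul_le_mul_of_nonneg_left hΔ (Nat.cast_nonneg t))
  rw [mul_div_assoc'] at this
  rw [le_div_iff₀ (lt_of_lt_of_le one_pos hsqrt1)] at this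
  linarith

/-! ### The circuit form: `Σ₃^⊕` circuits with a threshold gate on top -/

/-- A parity constraint `⟨s, x⟩ ⊕ ⟨t, y⟩ = b` over `𝔽₂` on `(x, y) ∈ {0,1}^m × {0,1}^m` (a bottom
`⊕`-gate of a `Σ₃^⊕` circuit together with the value the AND gate above requires).
[cite: Jukna2012, §11.7–§11.9 (`Σ₃^⊕` circuits)] -/
structure XorConstraint (m : ℕ) where
  /-- the `x`-variables in the parity -/
  s : Fin m → Bool
  /-- the `y`-variables in the parity -/
  t : Fin m → Bool
  /-- the required value -/
  b : Bool

/-- **A `Σ₃^⊕` circuit with a threshold gate on top**: `t` AND gates, each a conjunction of parity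
constraints, and a threshold `k`; it accepts iff at least `k` AND gates are satisfied.
[cite: Jukna2012, Theorem 11.31 (p. 336: "`Σ₃^⊕` circuit which has an arbitrary threshold gate on the top")] -/
structure ThrAndXor (m t : ℕ) where
  /-- the AND gates, as lists of parity constraints -/
  gates : Fin t → List (XorConstraint m)
  /-- the threshold of the top gate -/
  k : ℕ

namespace ThrAndXor

variable {m t : ℕ}

/-- The `i`-th AND gate accepts `(x, y)` iff all its parity constraints hold (`⟨s, x⟩ = ipBool s x`).
[cite: Jukna2012, §11.9 (p. 336)] -/
def gateAcc (C : ThrAndXor m t) (i : Fin t) (x y : Fin m → Bool) : Bool :=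
  (C.gates i).all fun c => (xor (ipBool c.s x) (ipBool c.t y) == c.b)

/-- The circuit accepts iff at least `k` AND gates accept. [cite: Jukna2012, §11.9 (p. 336)] -/
def eval (C : ThrAndXor m t) (x y : Fin m → Bool) : Bool :=
  decide (C.k ≤ ((univ : Finset (Fin t)).filter fun i => C.gateAcc i x y = true).card)

/-- **An AND of parities accepts a fat matching** (the case of Lemma 11.26 needed here): `(x, y)` is
accepted iff the signature vectors `(⟨s_j, x⟩)_j` and `(⟨t_j, y⟩ ⊕ b_j)_j` coincide, so the accepted
set is the union of the vertex-disjoint bicliques indexed by signature vectors.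
[cite: Jukna2012, Lemma 11.26 (p. 333) and Theorem 11.31 (p. 336)] -/
theorem isFatMatching_gate (C : ThrAndXor m t) (i : Fin t) :
    IsFatMatching ((univ : Finset ((Fin m → Bool) × (Fin m → Bool))).filter
      fun p => C.gateAcc i p.1 p.2 = true) := by
  classical
  refine ⟨fun x => Encodable.encode ((C.gates i).map fun c => ipBool c.s x) + 1,
    fun y => Encodable.encode ((C.gates i).map fun c => xor (ipBool c.t y) c.b) + 1, fun x y => ?_⟩
  simp only [mem_filter, mem_univ, true_and, gateAcc, List.all_eq_true, beq_iff_eq, ne_eq,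
    Nat.succ_ne_zero, not_false_eq_true, add_left_inj, Encodable.encode_inj]
  rw [List.map_eq_map_iff]
  refine forall₂_congr fun c _ => ?_
  cases ipBool c.s x <;> cases ipBool c.t y <;> cases c.b <;> simp

end ThrAndXor

/-- **Corollary 11.32 (Jukna; Theorem 11.31 for the `IP` Hadamard graph), circuit form.** Every
`Σ₃^⊕` circuit with a threshold gate on top that computes `IP_m` (`m ≥ 1`) has top fan-in
`t ≥ √(2^m)/4 = Ω(2^{m/2})`. [cite: Jukna2012, Corollary 11.32 (p. 336)] -/
theorem Jukna2012_cor1132_circuit {m t : ℕ} (hm : 1 ≤ m) (C : ThrAndXor m t)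
    (hC : ∀ x y, C.eval x y = ipBool x y) : Real.sqrt ((2 : ℝ) ^ m) ≤ 4 * t := by
  classical
  refine Jukna2012_cor1132 hm (fun i => univ.filter fun p => C.gateAcc i p.1 p.2 = true)
    (fun i => C.isFatMatching_gate i) C.k fun z => ?_
  simp only [mem_filter, mem_univ, true_and]
  rw [← hC z.1 z.2, ThrAndXor.eval, decide_eq_true_iff]

/-! ### Theorem 11.25: fat matchings inside `K_{a,b}`-free graphs are small -/

namespace IsFatMatching

variable {X Y : Type*} [Fintype X] [DecidableEq X] [Fintype Y] [DecidableEq Y]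

/-- The block decomposition of a fat matching: `F = ⨆_{k ∈ L} S_k × R_k` with the `S_k` pairwise
disjoint and the `R_k` pairwise disjoint. [cite: Jukna2012, §11.7 (fat matchings)] -/
private theorem blocks {F : Finset (X × Y)} (hF : IsFatMatching F) :
    ∃ (L : Finset ℕ) (S : ℕ → Finset X) (R : ℕ → Finset Y),
      F = L.biUnion (fun k => S k ×ˢ R k) ∧ (L : Set ℕ).PairwiseDisjoint (fun k => S k ×ˢ R k) ∧
      (∑ k ∈ L, (S k).card) ≤ Fintype.card X ∧ (∑ k ∈ L, (R k).card) ≤ Fintype.card Y := by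
  classical
  obtain ⟨c, d, hcd⟩ := hF
  refine ⟨((univ : Finset X).image c).erase 0, fun k => univ.filter fun x => c x = k,
    fun k => univ.filter fun y => d y = k, ?_, ?_, ?_, ?_⟩
  · ext ⟨x, y⟩
    simp only [mem_biUnion, mem_product, mem_filter, mem_univ, true_and, mem_erase, mem_image]
    constructor
    · intro h
      obtain ⟨h0, hxy⟩ := (hcd x y).1 h
      exact ⟨c x, ⟨h0, x, rfl⟩, rfl, hxy.symm⟩
    · rintro ⟨k, ⟨hk0, _⟩, hx, hy⟩
      exact (hcd x y).2 ⟨hx ▸ hk0, hx.trans hy.symm⟩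
  · intro k _ k' _ hkk'
    rw [Function.onFun, disjoint_left]
    rintro ⟨x, y⟩ h h'
    rw [mem_product] at h h'
    simp only [mem_filter, mem_univ, true_and] at h h'
    exact hkk' (h.1.symm.trans h'.1)
  · rw [Finset.sum_card_fiberwise_eq_card_filter, ← Finset.card_univ]
    exact card_filter_le _ _
  · rw [Finset.sum_card_fiberwise_eq_card_filter, ← Finset.card_univ]
    exact card_filter_le _ _

/-- **A fat matching inside a `K_{a,b}`-free graph has at most `(a−1)|Y| + (b−1)|X|` edges**: each
block `S × R ⊆ G` has `|S| < a` or `|R| < b`, hence `|S|·|R| ≤ (a−1)|R| + (b−1)|S|`, and the blocks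
have disjoint sides. [cite: Jukna2012, Theorem 11.25 and Lemma 11.27 (pp. 333–334)] -/
theorem card_le_of_free {F G : Finset (X × Y)} (hF : IsFatMatching F) (hFG : F ⊆ G) {a b : ℕ}
    (hfree : ∀ (S : Finset X) (R : Finset Y), S ×ˢ R ⊆ G → S.card < a ∨ R.card < b) :
    F.card ≤ (a - 1) * Fintype.card Y + (b - 1) * Fintype.card X := by
  classical
  obtain ⟨L, S, R, hFeq, hdisj, hS, hR⟩ := hF.blocks
  have hblock : ∀ k ∈ L, ((S k ×ˢ R k).card) ≤ (a - 1) * (R k).card + (b - 1) * (S k).card := by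
    intro k hk
    have hsub : S k ×ˢ R k ⊆ G := by
      refine Subset.trans ?_ hFG
      rw [hFeq]; exact Finset.subset_biUnion_of_mem (fun k => S k ×ˢ R k) hk
    rw [card_product]
    rcases hfree (S k) (R k) hsub with h | h
    · calc (S k).card * (R k).card ≤ (a - 1) * (R k).card := Nat.mul_le_mul_right _ (by omega)
        _ ≤ (a - 1) * (R k).card + (b - 1) * (S k).card := Nat.le_add_right _ _
    · calc (S k).card * (R k).card ≤ (S k).card * (b - 1) := Nat.mul_le_mul_left _ (by omega)
        _ = (b - 1) * (S k).card := mul_comm _ _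
        _ ≤ (a - 1) * (R k).card + (b - 1) * (S k).card := Nat.le_add_left _ _
  rw [hFeq, card_biUnion hdisj]
  calc ∑ k ∈ L, (S k ×ˢ R k).card ≤ ∑ k ∈ L, ((a - 1) * (R k).card + (b - 1) * (S k).card) :=
        sum_le_sum hblock
    _ = (a - 1) * ∑ k ∈ L, (R k).card + (b - 1) * ∑ k ∈ L, (S k).card := by
        rw [sum_add_distrib, mul_sum, mul_sum]
    _ ≤ (a - 1) * Fintype.card Y + (b - 1) * Fintype.card X :=
        add_le_add (Nat.mul_le_mul_left _ hR) (Nat.mul_le_mul_left _ hS)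

end IsFatMatching

/-- **Theorem 11.25 (set form).** If a bipartite graph `G ⊆ X × Y` is `K_{a,b}`-free and is the union of
`t` fat matchings, then `|G| ≤ t·((a−1)|Y| + (b−1)|X|)` — "every `Σ₃^⊕` circuit for `G` has top
fanin at least `|G|/((a+b)n)`". [cite: Jukna2012, Theorem 11.25 (p. 333)] -/
theorem Jukna2012_thm1125 {X Y : Type*} [Fintype X] [DecidableEq X] [Fintype Y] [DecidableEq Y]
    (G : Finset (X × Y)) {a b : ℕ}
    (hfree : ∀ (S : Finset X) (R : Finset Y), S ×ˢ R ⊆ G → S.card < a ∨ R.card < b)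
    {t : ℕ} (F : Fin t → Finset (X × Y)) (hF : ∀ i, IsFatMatching (F i)) (hFG : ∀ i, F i ⊆ G)
    (hcov : ∀ p ∈ G, ∃ i, p ∈ F i) :
    G.card ≤ t * ((a - 1) * Fintype.card Y + (b - 1) * Fintype.card X) := by
  classical
  have hsub : G ⊆ (univ : Finset (Fin t)).biUnion F := fun p hp => by
    obtain ⟨i, hi⟩ := hcov p hp
    exact mem_biUnion.2 ⟨i, mem_univ _, hi⟩
  calc G.card ≤ ((univ : Finset (Fin t)).biUnion F).card := card_le_card hsub
    _ ≤ ∑ i, (F i).card := card_biUnion_le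
    _ ≤ ∑ _i : Fin t, ((a - 1) * Fintype.card Y + (b - 1) * Fintype.card X) :=
        sum_le_sum fun i _ => (hF i).card_le_of_free (hFG i) hfree
    _ = t * ((a - 1) * Fintype.card Y + (b - 1) * Fintype.card X) := by
        rw [sum_const, card_univ, Fintype.card_fin, smul_eq_mul]

/-- **Theorem 11.25, circuit form**: a `Σ₃^⊕` circuit with an OR gate on top (threshold `1`)
accepting exactly a `K_{a,b}`-free set `G ⊆ {0,1}^m × {0,1}^m` has top fan-in `t` with
`|G| ≤ t·((a−1) + (b−1))·2^m`. [cite: Jukna2012, Theorem 11.25 (p. 333)] -/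
theorem Jukna2012_thm1125_circuit {m t : ℕ} (C : ThrAndXor m t) (hk : C.k = 1)
    (G : Finset ((Fin m → Bool) × (Fin m → Bool))) (hC : ∀ x y, C.eval x y = true ↔ (x, y) ∈ G)
    {a b : ℕ} (hfree : ∀ (S R : Finset (Fin m → Bool)), S ×ˢ R ⊆ G → S.card < a ∨ R.card < b) :
    G.card ≤ t * (((a - 1) + (b - 1)) * 2 ^ m) := by
  classical
  have hacc : ∀ x y, C.eval x y = true ↔ ∃ i, C.gateAcc i x y = true := by
    intro x y
    rw [ThrAndXor.eval, hk, decide_eq_true_iff]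
    constructor
    · intro h
      obtain ⟨i, hi⟩ := Finset.card_pos.1 h
      exact ⟨i, (mem_filter.1 hi).2⟩
    · rintro ⟨i, hi⟩
      exact Finset.card_pos.2 ⟨i, mem_filter.2 ⟨mem_univ _, hi⟩⟩
  have h := Jukna2012_thm1125 G hfree (fun i => univ.filter fun p => C.gateAcc i p.1 p.2 = true)
    (fun i => C.isFatMatching_gate i)
    (fun i p hp => (hC p.1 p.2).1 ((hacc p.1 p.2).2 ⟨i, (mem_filter.1 hp).2⟩))
    (fun p hp => by
      obtain ⟨i, hi⟩ := (hacc p.1 p.2).1 ((hC p.1 p.2).2 hp)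
      exact ⟨i, mem_filter.2 ⟨mem_univ _, hi⟩⟩)
  have hcard : Fintype.card (Fin m → Bool) = 2 ^ m := by
    rw [Fintype.card_fun, Fintype.card_bool, Fintype.card_fin]
  rw [hcard] at h
  calc G.card ≤ t * ((a - 1) * 2 ^ m + (b - 1) * 2 ^ m) := h
    _ = t * (((a - 1) + (b - 1)) * 2 ^ m) := by ring

/-! ### Theorem 11.29: `Σ₃^⊕` circuits for disjointness -/

/-- The disjointness graph on `{0,1}^m × {0,1}^m`: `(x, y)` with no common `1`
(`DISJ_{2m}(x, y) = 1`). [cite: Jukna2012, Theorem 11.29 (proof, p. 334)] -/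
def disjGraph (m : ℕ) : Finset ((Fin m → Bool) × (Fin m → Bool)) :=
  univ.filter fun p => ∀ i, (p.1 i && p.2 i) = false

/-- **`|DISJ| = 3^m`**: a pair of disjoint subsets of `[m]` is a map `[m] → {(0,0), (1,0), (0,1)}`.
[cite: Jukna2012, Theorem 11.29 (proof, p. 335: "`|G_m| = Σ_u 2^{m−|u|} = 3^m`")] -/
theorem card_disjGraph (m : ℕ) : (disjGraph m).card = 3 ^ m := by
  classical
  let T := {q : Bool × Bool // (q.1 && q.2) = false}
  have hT : Fintype.card T = 3 := by decide
  have h1 : (disjGraph m).card =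
      Fintype.card {p : (Fin m → Bool) × (Fin m → Bool) // ∀ i, (p.1 i && p.2 i) = false} := by
    rw [disjGraph, Fintype.card_subtype]
  rw [h1]
  let e : {p : (Fin m → Bool) × (Fin m → Bool) // ∀ i, (p.1 i && p.2 i) = false} ≃ (Fin m → T) :=
    { toFun := fun p i => ⟨(p.1.1 i, p.1.2 i), p.2 i⟩
      invFun := fun f => ⟨(fun i => (f i).1.1, fun i => (f i).1.2), fun i => (f i).2⟩
      left_inv := fun p => by rfl
      right_inv := fun f => by rfl }
  rw [Fintype.card_congr e, Fintype.card_fun, Fintype.card_fin, hT]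

/-- **`DISJ` has no large bicliques**: if `S × R ⊆ DISJ` then `|S|·|R| ≤ 2^m` (the supports
`A = ⋃ S`, `B = ⋃ R` are disjoint, `S ⊆ 2^A`, `R ⊆ 2^B`).
[cite: Jukna2012, Theorem 11.29 (proof, p. 334: "if `S × T` is a clique, then … `|S|·|T| ≤ 2^m`")] -/
theorem disjGraph_biclique {m : ℕ} (S R : Finset (Fin m → Bool)) (h : S ×ˢ R ⊆ disjGraph m) :
    S.card * R.card ≤ 2 ^ m := by
  classical
  -- supports
  let A : Finset (Fin m) := univ.filter fun i => ∃ u ∈ S, u i = true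
  let B : Finset (Fin m) := univ.filter fun i => ∃ v ∈ R, v i = true
  have hAB : Disjoint A B := by
    rw [Finset.disjoint_left]
    intro i hiA hiB
    obtain ⟨u, hu, hui⟩ := (mem_filter.1 hiA).2
    obtain ⟨v, hv, hvi⟩ := (mem_filter.1 hiB).2
    have hp := mem_filter.1 (h (show (u, v) ∈ S ×ˢ R from mem_product.2 ⟨hu, hv⟩))
    have := hp.2 i
    simp [hui, hvi] at this
  -- `S ↪ 𝒫(A)`, `R ↪ 𝒫(B)` by taking supports
  have hS : S.card ≤ 2 ^ A.card := by
    rw [← card_powerset]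
    refine card_le_card_of_injOn (fun u => univ.filter fun i => u i = true) (fun u hu => ?_) ?_
    · rw [mem_coe, mem_powerset]
      intro i hi
      exact mem_filter.2 ⟨mem_univ _, u, hu, (mem_filter.1 hi).2⟩
    · intro u _ u' _ huu'
      funext i
      have := congrArg (fun s : Finset (Fin m) => i ∈ s) huu'
      simp only [mem_filter, mem_univ, true_and, eq_iff_iff] at this
      cases hu : u i <;> cases hu' : u' i <;> simp_all
  have hR : R.card ≤ 2 ^ B.card := by
    rw [← card_powerset]
    refine card_le_card_of_injOn (fun v => univ.filter fun i => v i = true) (fun v hv => ?_) ?_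
    · rw [mem_coe, mem_powerset]
      intro i hi
      exact mem_filter.2 ⟨mem_univ _, v, hv, (mem_filter.1 hi).2⟩
    · intro v _ v' _ hvv'
      funext i
      have := congrArg (fun s : Finset (Fin m) => i ∈ s) hvv'
      simp only [mem_filter, mem_univ, true_and, eq_iff_iff] at this
      cases hv : v i <;> cases hv' : v' i <;> simp_all
  have hABm : A.card + B.card ≤ m := by
    rw [← card_union_of_disjoint hAB]
    exact (card_le_univ _).trans (by simp)
  calc S.card * R.card ≤ 2 ^ A.card * 2 ^ B.card := Nat.mul_le_mul hS hR
    _ = 2 ^ (A.card + B.card) := (pow_add _ _ _).symm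
    _ ≤ 2 ^ m := Nat.pow_le_pow_right (by norm_num) hABm

/-- **Theorem 11.29.** Every `Σ₃^⊕` circuit (OR of ANDs of parities of the `2m` variables) computing
`DISJ_{2m}(x, y) = [x ∩ y = ∅]` has top fan-in `t` with `3^m ≤ t · ⌊√(2^m)⌋ · 2^{m+1}` — since
`3/2^{3/2} > 2^{0.08}`, `t ≥ 2^{0.08 m}/2` (the book's `2^{0.08 m}`, from Theorem 11.25 with
`a = b = ⌊√n⌋ + 1`, `|G_m| = 3^m`). [cite: Jukna2012, Theorem 11.29 (pp. 334–335)] -/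
theorem Jukna2012_thm1129 {m t : ℕ} (C : ThrAndXor m t) (hk : C.k = 1)
    (hC : ∀ x y, C.eval x y = decide (∀ i, (x i && y i) = false)) :
    3 ^ m ≤ t * (2 * Nat.sqrt (2 ^ m) * 2 ^ m) := by
  classical
  have hG : ∀ x y, C.eval x y = true ↔ (x, y) ∈ disjGraph m := by
    intro x y
    rw [hC, decide_eq_true_iff, disjGraph]
    simp
  have hfree : ∀ (S R : Finset (Fin m → Bool)), S ×ˢ R ⊆ disjGraph m →
      S.card < Nat.sqrt (2 ^ m) + 1 ∨ R.card < Nat.sqrt (2 ^ m) + 1 := by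
    intro S R hSR
    have hle := disjGraph_biclique S R hSR
    by_contra hnot
    push Not at hnot
    have h1 : Nat.sqrt (2 ^ m) + 1 ≤ S.card := hnot.1
    have h2 : Nat.sqrt (2 ^ m) + 1 ≤ R.card := hnot.2
    have h3 := Nat.mul_le_mul h1 h2
    have h4 : 2 ^ m < (Nat.sqrt (2 ^ m) + 1) * (Nat.sqrt (2 ^ m) + 1) := by
      have := Nat.lt_succ_sqrt' (2 ^ m)
      rwa [Nat.succ_eq_add_one, pow_two] at this
    omega
  have h := Jukna2012_thm1125_circuit C hk (disjGraph m) hG hfree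
  rw [card_disjGraph] at h
  calc 3 ^ m ≤ t * ((Nat.sqrt (2 ^ m) + 1 - 1 + (Nat.sqrt (2 ^ m) + 1 - 1)) * 2 ^ m) := h
    _ = t * (2 * Nat.sqrt (2 ^ m) * 2 ^ m) := by
        rw [Nat.add_sub_cancel]; ring

end Literature.Computability.Complexity
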